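import Literature.AlgebraicGeometry.HodgeTheory.FermatAffineChart
import Literature.AlgebraicGeometry.Motives.HypersurfaceChartHyperplaneSection
import Literature.AlgebraicGeometry.Motives.VarietiesGeometricallyIntegralProofs
import Literature.AlgebraicGeometry.Motives.FermatHypersurface
import HarnessLib

/-!
# The ideal of the coordinate section `Xⁿₘ ⊂ Xⁿ⁺¹ₘ` on the charts of the Fermat variety

Family `hodge`, layer `Literature/AlgebraicGeometry/HodgeTheory`. Theorem-only file (sorry-free,
no named fact). For the standard Fermat varieties
`Xᴺₘ = SmoothHypersurface.hypersurface (fermatPolynomial ℂ N m) ⊂ ℙᴺ⁺¹_ℂ` and the coordinate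
section `fermatSection k₀ : Xⁿₘ ⟶ Xⁿ⁺¹ₘ` (`{x_{k₀} = 0}`, `HodgeTheory/FermatCoordinateSection`), we
prove the scheme-theoretic statement behind Shioda–Katsura's inductive structure (Tôhoku Math. J.
31 (1979), §1 (1.1)–(1.4): the centre `Xʳₘ × X⁰ₘ` of the blow-up is the transversal intersection
`{x_{r+2} = 0} ∩ {y₂ = 0}`): **on the affine chart `W = Xⁿ⁺¹ₘ ∩ D₊(xᵢ ∂ⱼF)` (`i, j ≠ k₀`) the ideal
of the closed immersion `fermatSection k₀` is generated by the single regular function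
`u = x_{k₀}/xᵢ`**, a nonzerodivisor of the domain `Γ(Xⁿ⁺¹ₘ, W)`, and these charts cover the section:

* `ker_eq_vanishingIdeal_of_isReduced` — a quasi-compact morphism from a reduced scheme has
  scheme-theoretic image the reduced induced structure on the closure of its image;
* `ker_comp_ideal_eq_comap` / `ker_ideal_preimage_eq_map` — kernel ideals through a closed
  immersion into the ambient space;
* `vanishingIdeal_awayι_preimage_fermat_section` — in the chart algebra
  `S = ℂ[y][1/∂ⱼf] ≅ Γ(ℙ, D₊(xᵢ ∂ⱼF))`, the vanishing ideal of `V₊(F) ∩ V₊(x_{k₀})` is `(y_{a₀}, f)`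
  (`Motives/HypersurfaceChartHyperplaneSection`: `S/(y_{a₀}, f)` is reduced — the Jacobian
  criterion for the hyperplane section);
* `ker_fermatSection_ideal_chart` — `(ker fermatSection k₀)(W) = (u)`;
* `appChart_mem_nonZeroDivisors` — `u` is a nonzerodivisor;
* `exists_chart_of_mem_fermatCoordHyperplane` — the charts `W` with `i, j ≠ k₀` cover
  `{x_{k₀} = 0} ∩ Xⁿ⁺¹ₘ`.

## References

* T. Shioda, T. Katsura, On Fermat varieties, Tôhoku Math. J. 31 (1979) 97–115, §1 (1.1)–(1.4),
  Lemma 1.2. [ShiodaKatsura1979]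
* R. Hartshorne, *Algebraic Geometry* (1977): I Ex. 5.8, II Example 3.2.6, II Ex. 3.11 (d),
  III Thm. 10.2. [Hartshorne1977]
-/

noncomputable section

open CategoryTheory AlgebraicGeometry MvPolynomial TopologicalSpace HomogeneousLocalization

universe u

namespace Literature.AlgebraicGeometry.HodgeTheory

open Literature.AlgebraicGeometry.Motives Literature.AlgebraicGeometry.Motives.SmoothHypersurface
  Literature.AlgebraicGeometry.Motives.ProjectiveSpace Literature.AlgebraicGeometry.Motives.ProjSubscheme

/-! ### Kernel ideal sheaves: reduced sources and closed immersions into the ambient space -/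

section General

variable {X Y P : Scheme.{u}}

/-- **The scheme-theoretic image of a reduced scheme is reduced**: for a quasi-compact morphism
`f : X → Y` from a reduced scheme, the kernel ideal sheaf of `f` is the vanishing ideal sheaf
(reduced induced structure, Hartshorne II Example 3.2.6 / Ex. 3.11 (d)) of the closure of the
image. [cite: Hartshorne1977, II Ex. 3.11 (d)] -/
theorem ker_eq_vanishingIdeal_of_isReduced (f : X ⟶ Y) [QuasiCompact f] [IsReduced X] :
    f.ker = Scheme.IdealSheafData.vanishingIdeal ⟨closure (Set.range f), isClosed_closure⟩ := by
  have hsupp : f.ker.support = ⟨closure (Set.range f), isClosed_closure⟩ :=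
    Closeds.ext (Scheme.Hom.support_ker f)
  have hrad : f.ker.radical = f.ker := by
    ext U : 2
    rw [Scheme.IdealSheafData.radical_ideal, Scheme.Hom.ker_apply]
    refine (Ideal.IsRadical.radical fun s ⟨k, hk⟩ ↦ ?_)
    rw [RingHom.mem_ker] at hk ⊢
    rw [map_pow] at hk
    exact IsReduced.eq_zero _ ⟨k, hk⟩
  rw [← hsupp, Scheme.IdealSheafData.vanishingIdeal_support, hrad]

/-- **Kernel ideals through a closed immersion into the ambient space**: for `g : Y → X` and a
closed immersion `ι : X ↪ P`, on an affine open `U ⊆ P`,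
`ker(g ≫ ι)(U) = (ι^*)⁻¹ (ker g)(ι⁻¹U)`. [folklore] -/
theorem ker_comp_ideal_eq_comap (g : Y ⟶ X) (ι : X ⟶ P) [QuasiCompact g] [IsClosedImmersion ι]
    (U : P.affineOpens) :
    (g ≫ ι).ker.ideal U =
      (g.ker.ideal ⟨ι ⁻¹ᵁ (U : P.Opens), U.2.preimage ι⟩).comap (ι.app U).hom := by
  rw [Scheme.Hom.ker_apply, Scheme.Hom.ker_apply, Scheme.Hom.comp_app]
  exact (RingHom.comap_ker _ _).symm

/-- Hence `(ker g)(ι⁻¹U) = ι^* (ker(g ≫ ι)(U))`, `ι^*` being surjective on affine opens.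
[folklore] -/
theorem ker_ideal_preimage_eq_map (g : Y ⟶ X) (ι : X ⟶ P) [QuasiCompact g] [IsClosedImmersion ι]
    (U : P.affineOpens) :
    g.ker.ideal ⟨ι ⁻¹ᵁ (U : P.Opens), U.2.preimage ι⟩ = ((g ≫ ι).ker.ideal U).map (ι.app U).hom := by
  rw [ker_comp_ideal_eq_comap, Ideal.map_comap_of_surjective _ (ι.app_surjective U U.2)]

/-- The pull-back `ι^* s` of a section of the ideal of `X` in `P` vanishes. [folklore] -/
theorem app_eq_zero_of_mem_ker_ideal (ι : X ⟶ P) [IsClosedImmersion ι] (U : P.affineOpens)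
    {s : Γ(P, U)} (hs : s ∈ ι.ker.ideal U) : ι.app U s = 0 := by
  rwa [Scheme.Hom.ker_apply, RingHom.mem_ker] at hs

/-- Ideal bookkeeping: `ψ(φ(a, f)) = (ψ φ a)` when `ψ (φ f) = 0`. [folklore] -/
theorem map_map_span_pair_eq {A B C : Type*} [CommRing A] [CommRing B] [CommRing C]
    (φ : A →+* B) (ψ : B →+* C) (a f : A) (hf : ψ (φ f) = 0) :
    ((Ideal.span {a, f}).map φ).map ψ = Ideal.span {ψ (φ a)} := by
  rw [Ideal.map_map, Ideal.map_span, Set.image_pair, RingHom.comp_apply, RingHom.comp_apply, hf,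
    Set.pair_comm, Ideal.span_insert_zero]

end General

/-! ### The Fermat charts -/

section Fermat

attribute [local instance] MvPolynomial.gradedAlgebra Motives.ProjBaseChange.algebraBase
  Motives.ProjBaseChange.isScalarTower_localization

variable {n : ℕ} {m : ℕ}

/-- The grading of `ℂ[x₀, …, x_{n+2}]` (`ℙⁿ⁺² = Proj 𝓐`, ambient space of `Xⁿ⁺¹ₘ`). [folklore] -/
local notation "𝓐" => MvPolynomial.homogeneousSubmodule (Fin (n + 3)) ℂ

/-- Local notation: the standard Fermat hypersurface `Xⁿₘ`. -/
local notation "𝕏" n' ", " m' => SmoothHypersurface.hypersurface (fermatPolynomial ℂ n' m')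

/-- Local notation: the Fermat form `F = x₀ᵐ + ⋯ + x_{n+2}ᵐ` of `Xⁿ⁺¹ₘ`. -/
local notation "F" => fermatPolynomial ℂ (n + 1) m

set_option quotPrecheck false in
/-- Local notation: the ambient projective space `ℙⁿ⁺²_ℂ` as a scheme. -/
local notation "ℙ" => (projectiveSpace (n + 1 + 1) ℂ).left

set_option quotPrecheck false in
/-- Local notation: the closed immersion `Xⁿ⁺¹ₘ ↪ ℙⁿ⁺²` of underlying schemes. -/
local notation "ιX" => (SmoothHypersurface.hypersurfaceι (fermatPolynomial ℂ (n + 1) m)).left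

/-- The Fermat form of `Xⁿ⁺¹ₘ` is homogeneous of degree `m`. [folklore] -/
theorem isHomogeneous_fermatPolynomial_succ : (fermatPolynomial ℂ (n + 1) m).IsHomogeneous m :=
  isHomogeneous_fermatPolynomial (n + 1) m

/-- Local notation: the homogeneity proof of `F` (argument of `chartOpen`). -/
local notation "hF" => isHomogeneous_fermatPolynomial_succ (n := n) (m := m)

variable (i : Fin (n + 3)) (a₀ : Fin (n + 2)) (j' : Fin (n + 1))

/-- `∂F/∂x_{i.succAbove j} ∈ 𝓐_{m-1}`, `j = a₀.succAbove j'`. [folklore] -/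
theorem pderiv_fermatPolynomial_mem_homogeneousSubmodule :
    pderiv (i.succAbove (a₀.succAbove j')) F ∈ 𝓐 (m - 1) :=
  (isHomogeneous_fermatPolynomial_succ (n := n) (m := m)).pderiv

/-- The chart algebra `S = (ℂ[x]_{xᵢ h})₀ = ℂ[y][1/h(xᵢ := 1)]`, `h = ∂F/∂x_{i.succAbove j}`,
`j = a₀.succAbove j'`. -/
local notation "S" => Away 𝓐 (X i * pderiv (i.succAbove (a₀.succAbove j')) F)

set_option quotPrecheck false in
/-- The dehomogenised section coordinate `y_{a₀} = x_{k₀}/xᵢ`, `k₀ = i.succAbove a₀`, read in `S`. -/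
local notation "uS" => chartMap ℂ i (pderiv_fermatPolynomial_mem_homogeneousSubmodule (n := n) (m := m) i a₀ j') (X a₀)

set_option quotPrecheck false in
/-- The dehomogenised Fermat equation `f = F(xᵢ := 1)` read in `S`. -/
local notation "fS" => chartMap ℂ i (pderiv_fermatPolynomial_mem_homogeneousSubmodule (n := n) (m := m) i a₀ j') (dehomogenize ℂ i F)

set_option quotPrecheck false in
/-- The chart `D₊(xᵢ ∂ⱼF)`, `j = a₀.succAbove j'`, as an affine open of `ℙⁿ⁺²`. -/
local notation "WP" => (⟨(chartOpen F hF i (a₀.succAbove j') : (Proj 𝓐).Opens),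
  (chartOpen F hF i (a₀.succAbove j')).2⟩ : Scheme.affineOpens ℙ)

/-- **`V₊(F) ∩ V₊(x_{k₀})` in the chart `D₊(xᵢ ∂ⱼF)`, `i, j ≠ k₀`, is `V(y_{a₀}, f)` with the
REDUCED ideal `(y_{a₀}, f)`**: the vanishing ideal of the preimage of `V₊(F) ∩ V₊(x_{k₀})` under
`Spec S → ℙⁿ⁺²` is `(y_{a₀}, f) ⊆ S` (`awayι⁻¹ V₊(G) = V(G(xᵢ := 1))`,
`ProjSubscheme.awayι_mul_preimage_zeroLocus`; the ideal `(y_{a₀}, f)` is radical because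
`S/(y_{a₀}, f)` is standard smooth, `Motives/HypersurfaceChartHyperplaneSection`). Here `m ≥ 1`.
[cite: Hartshorne1977, I Ex. 5.8 and III Thm. 10.2] [cite: ShiodaKatsura1979, §1 (1.1)–(1.4)] -/
theorem vanishingIdeal_awayι_preimage_fermat_section (hm : 1 ≤ m) :
    PrimeSpectrum.vanishingIdeal
      ((Proj.awayι 𝓐 (X i * pderiv (i.succAbove (a₀.succAbove j')) F)
          (X_mul_pderiv_mem F hF i (a₀.succAbove j')) (one_add_pos m)) ⁻¹'
        (ProjectiveSpectrum.zeroLocus 𝓐 {F} ∩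
          ProjectiveSpectrum.zeroLocus 𝓐 {X (i.succAbove a₀)})) = Ideal.span {uS, fS} := by
  -- the two preimages
  have h1 := awayι_mul_preimage_zeroLocus 𝓐 (X_mem i) Nat.one_pos (pderiv_fermatPolynomial_mem_homogeneousSubmodule (n := n) (m := m) i a₀ j') rfl hF hm
  have h2 := awayι_mul_preimage_zeroLocus 𝓐 (X_mem i) Nat.one_pos (pderiv_fermatPolynomial_mem_homogeneousSubmodule (n := n) (m := m) i a₀ j') rfl
    (X_mem (i.succAbove a₀)) Nat.one_pos
  rw [← chartMap_dehomogenize] at h1 h2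
  rw [dehomogenize_X_succAbove] at h2
  rw [Set.preimage_inter]
  erw [h1, h2]
  rw [← PrimeSpectrum.zeroLocus_union, Set.singleton_union, Set.pair_comm,
    ← PrimeSpectrum.zeroLocus_span, PrimeSpectrum.vanishingIdeal_zeroLocus_eq_radical]
  -- the ideal `(y_{a₀}, f)` is radical: `S/(y_{a₀}, f)` is reduced
  letI : Algebra (MvPolynomial (Fin (n + 2)) ℂ) S := (chartMap ℂ i (pderiv_fermatPolynomial_mem_homogeneousSubmodule (n := n) (m := m) i a₀ j')).toRingHom.toAlgebra
  haveI : IsScalarTower ℂ (MvPolynomial (Fin (n + 2)) ℂ) S :=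
    IsScalarTower.of_algebraMap_eq fun r => ((chartMap ℂ i (pderiv_fermatPolynomial_mem_homogeneousSubmodule (n := n) (m := m) i a₀ j')).commutes r).symm
  haveI : IsLocalization.Away (pderiv (a₀.succAbove j') (dehomogenize ℂ i F)) S := by
    rw [pderiv_dehomogenize]
    exact isLocalization_chartMap ℂ i (pderiv_fermatPolynomial_mem_homogeneousSubmodule (n := n) (m := m) i a₀ j')
  haveI hred := isReduced_quotient_span_pair ℂ (dehomogenize ℂ i F) a₀ j' S
  exact ((Ideal.isRadical_iff_quotient_reduced _).mpr hred).radical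

/-- The affine chart `W = Xⁿ⁺¹ₘ ∩ D₊(xᵢ ∂ⱼF)` of the Fermat variety, `j = a₀.succAbove j'`
(preimage of the affine `D₊(xᵢ ∂ⱼF)` under the affine morphism `ι`). [folklore] -/
theorem isAffineOpen_preimage_chartOpen :
    IsAffineOpen (ιX ⁻¹ᵁ (WP : Scheme.Opens ℙ)) :=
  (WP).2.preimage ιX

/-- The image of `Xⁿₘ ↪ Xⁿ⁺¹ₘ ↪ ℙⁿ⁺²` is `V₊(F) ∩ V₊(x_{k₀})` (`range_fermatSection`,
`range_hypersurfaceι`). [cite: ShiodaKatsura1979, §1 (1.1)] -/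
theorem range_fermatSection_comp_ι (hm : m ≠ 0) (k₀ : Fin (n + 3)) :
    Set.range ((fermatSection hm k₀).left ≫ ιX) =
      ProjectiveSpectrum.zeroLocus 𝓐 {F} ∩ ProjectiveSpectrum.zeroLocus 𝓐 {X k₀} := by
  have hrange : Set.range ιX = ProjectiveSpectrum.zeroLocus 𝓐 {F} :=
    SmoothHypersurface.range_hypersurfaceι F
  rw [Scheme.Hom.comp_base, TopCat.coe_comp, Set.range_comp, range_fermatSection hm k₀]
  ext p
  constructor
  · rintro ⟨x, hx, rfl⟩
    exact ⟨(Set.ext_iff.mp hrange _).mp ⟨x, rfl⟩, (mem_fermatCoordHyperplane_iff k₀ x).mp hx⟩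
  · rintro ⟨hpF, hpk⟩
    obtain ⟨x, rfl⟩ := (Set.ext_iff.mp hrange p).mpr hpF
    exact ⟨x, (mem_fermatCoordHyperplane_iff k₀ x).mpr hpk, rfl⟩

/-- **The ideal of the coordinate section on a chart is generated by the coordinate**
(Shioda–Katsura, §1: `Xⁿₘ = Xⁿ⁺¹ₘ ∩ {x_{k₀} = 0}` scheme-theoretically): on
`W = Xⁿ⁺¹ₘ ∩ D₊(xᵢ ∂ⱼF)` with `k₀ = i.succAbove a₀`, `j = a₀.succAbove j'`, the ideal of sections
of `ker (fermatSection k₀)` is generated by `u = ι^*(x_{k₀}/xᵢ)` (`m ≥ 1`).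
[cite: ShiodaKatsura1979, §1 (1.1)–(1.4)] [cite: Hartshorne1977, II Ex. 3.11 (d)] -/
theorem ker_fermatSection_ideal_chart (hm : 1 ≤ m) :
    (fermatSection (Nat.one_le_iff_ne_zero.mp hm) (i.succAbove a₀)).left.ker.ideal
        ⟨ιX ⁻¹ᵁ (WP : Scheme.Opens ℙ), isAffineOpen_preimage_chartOpen i a₀ j'⟩ =
      Ideal.span {(ιX).app (WP : Scheme.Opens ℙ) (Proj.awayToSection 𝓐 _ uS)} := by
  have hm0 : m ≠ 0 := Nat.one_le_iff_ne_zero.mp hm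
  haveI : IsReduced (𝕏 n, m).left :=
    isReduced_hypersurface (fermatPolynomial ℂ n m) (isHomogeneous_fermatPolynomial n m)
      (isNonsingularForm_sum_X_pow (Nat.cast_ne_zero.mpr hm0)) hm
  rw [ker_ideal_preimage_eq_map (fermatSection hm0 (i.succAbove a₀)).left ιX WP,
    ker_eq_vanishingIdeal_of_isReduced]
  have hcl : (⟨closure (Set.range ((fermatSection hm0 (i.succAbove a₀)).left ≫ ιX)),
      isClosed_closure⟩ : Closeds ℙ) =
      ⟨ProjectiveSpectrum.zeroLocus 𝓐 {F} ∩ ProjectiveSpectrum.zeroLocus 𝓐 {X (i.succAbove a₀)},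
        (ProjectiveSpectrum.isClosed_zeroLocus _ _).inter (ProjectiveSpectrum.isClosed_zeroLocus _ _)⟩ := by
    apply Closeds.ext
    change closure _ = _
    rw [range_fermatSection_comp_ι]
    exact ((ProjectiveSpectrum.isClosed_zeroLocus _ _).inter
      (ProjectiveSpectrum.isClosed_zeroLocus _ _)).closure_eq
  rw [hcl]
  erw [vanishingIdeal_ideal_affineBasicOpen 𝓐 _ (X_mul_pderiv_mem F hF i (a₀.succAbove j'))
    (one_add_pos m)]
  erw [Closeds.coe_mk, vanishingIdeal_awayι_preimage_fermat_section i a₀ j' hm]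
  -- `ι^* f = 0`
  have hf0 : ((ιX).app (WP : Scheme.Opens ℙ)) (Proj.awayToSection 𝓐 _ fS) = 0 := by
    apply app_eq_zero_of_mem_ker_ideal ιX WP
    rw [SmoothHypersurface.hypersurfaceι_left]
    erw [Scheme.IdealSheafData.ker_subschemeι]
    change _ ∈ (idealSheaf F).ideal (chartOpen F hF i (a₀.succAbove j'))
    rw [ideal_chartOpen_eq F hF i (a₀.succAbove j') hm]
    exact Ideal.mem_map_of_mem _ (Ideal.subset_span rfl)
  exact map_map_span_pair_eq _ _ _ _ hf0

/-! ### The generator is a nonzerodivisor -/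

/-- `Xⁿ⁺¹ₘ` has a point off the hyperplane `{x_{k₀} = 0}` (`m ≥ 1`): the complex point with
`x_{k₀} = 1`, `xᵢ = ζ`, `ζᵐ = -1`, all other coordinates `0`. [folklore] -/
theorem exists_notMem_fermatCoordHyperplane (hm : 1 ≤ m) {i k₀ : Fin (n + 3)} (hik : i ≠ k₀) :
    ∃ z : (𝕏 (n + 1), m).left, z ∉ fermatCoordHyperplane (n + 1) m k₀ := by
  obtain ⟨ζ, hζ⟩ : ∃ ζ : ℂ, ζ ^ m = -1 := IsAlgClosed.exists_pow_nat_eq (-1) hm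
  classical
  let c : Fin (n + 3) → ℂ := fun l ↦ if l = k₀ then 1 else if l = i then ζ else 0
  have hck : c k₀ = 1 := by simp [c]
  have hci : c i = ζ := by simp [c, hik]
  have hc0 : c ≠ 0 := fun h ↦ by simpa [hck] using congrFun h k₀
  have heval : MvPolynomial.eval c F = 0 := by
    rw [eval_fermatPolynomial, ← Finset.sum_subset (Finset.subset_univ {k₀, i})]
    · rw [Finset.sum_pair (Ne.symm hik), hck, hci, one_pow, hζ, add_neg_cancel]
    · intro l _ hl
      rw [Finset.mem_insert, Finset.mem_singleton, not_or] at hl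
      simp [c, hl.1, hl.2, zero_pow (Nat.one_le_iff_ne_zero.mp hm)]
  obtain ⟨Pz, hPz⟩ := exists_hypersurfacePoint_eq (Y := 𝕏 (n + 1), m)
    (ι := SmoothHypersurface.hypersurfaceι F) hF (SmoothHypersurface.range_hypersurfaceι _)
    ((mk_mem_projZeroLocus_singleton_iff hF c hc0).mpr heval)
  refine ⟨Pz.pt, (notMem_fermatCoordHyperplane_iff k₀ Pz).mpr ?_⟩
  rw [hPz, Projectivization.mk_mem_stdChartSource_iff, hck]
  exact one_ne_zero

/-- **`u = ι^*(x_{k₀}/xᵢ)` is a nonzerodivisor of `Γ(Xⁿ⁺¹ₘ, W)`**, `W = Xⁿ⁺¹ₘ ∩ D₊(xᵢ ∂ⱼF)`: the ring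
is a domain (`Xⁿ⁺¹ₘ` is integral) — or zero if `W = ∅` — and `u ≠ 0`, since otherwise
`(ker fermatSection)(W) = 0`, i.e. `W ⊆ {x_{k₀} = 0}`, whereas the non-empty opens `W` and
`{x_{k₀} ≠ 0}` of the irreducible `Xⁿ⁺¹ₘ` meet. [cite: ShiodaKatsura1979, §1 Lemma 1.2] -/
theorem appChart_mem_nonZeroDivisors (hm : 1 ≤ m) :
    (ιX).app (WP : Scheme.Opens ℙ) (Proj.awayToSection 𝓐 _ uS) ∈
      nonZeroDivisors Γ((𝕏 (n + 1), m).left, ιX ⁻¹ᵁ (WP : Scheme.Opens ℙ)) := by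
  have hm0 : m ≠ 0 := Nat.one_le_iff_ne_zero.mp hm
  by_cases hne : ((ιX ⁻¹ᵁ (WP : Scheme.Opens ℙ) : ((𝕏 (n + 1), m).left).Opens) :
    Set (𝕏 (n + 1), m).left).Nonempty
  swap
  · -- `W = ∅`: the zero ring
    have hbot : (ιX ⁻¹ᵁ (WP : Scheme.Opens ℙ) : ((𝕏 (n + 1), m).left).Opens) = ⊥ := by
      ext1; exact Set.not_nonempty_iff_eq_empty.mp hne
    haveI : Subsingleton Γ((𝕏 (n + 1), m).left, ιX ⁻¹ᵁ (WP : Scheme.Opens ℙ)) :=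
      CommRingCat.subsingleton_of_isTerminal
        (((𝕏 (n + 1), m).left.sheaf.isTerminalOfEqEmpty) hbot)
    exact ⟨fun x _ ↦ Subsingleton.elim _ _, fun x _ ↦ Subsingleton.elim _ _⟩
  haveI : Nonempty (ιX ⁻¹ᵁ (WP : Scheme.Opens ℙ) : ((𝕏 (n + 1), m).left).Opens) := by
    obtain ⟨z, hz⟩ := hne
    exact ⟨⟨z, hz⟩⟩
  haveI : IsIntegral (𝕏 (n + 1), m).left := IsSmoothProjective.isIntegral_holds
    (isSmoothProjective_hypersurface_fermatPolynomial_of_charZero (k := ℂ) (Nat.le_add_left 1 n) hm)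
  refine mem_nonZeroDivisors_of_ne_zero fun hu ↦ ?_
  -- if `u = 0` then `(ker fermatSection)(W) = 0` …
  have hker := ker_fermatSection_ideal_chart i a₀ j' hm
  rw [hu, Ideal.span_singleton_zero] at hker
  -- … so every point of `W` lies on `Z_{k₀} = {x_{k₀} = 0}` …
  have hWZ : ∀ z ∈ (ιX ⁻¹ᵁ (WP : Scheme.Opens ℙ) : ((𝕏 (n + 1), m).left).Opens),
      z ∈ fermatCoordHyperplane (n + 1) m (i.succAbove a₀) := by
    intro z hz
    have hsupp : z ∈ (fermatSection hm0 (i.succAbove a₀)).left.ker.support := by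
      rw [Scheme.IdealSheafData.mem_support_iff_of_mem (U := ⟨_, isAffineOpen_preimage_chartOpen
        i a₀ j'⟩) hz, hker, Submodule.bot_coe, Scheme.zeroLocus_singleton, Scheme.basicOpen_zero]
      simp
    have h2 : ((fermatSection hm0 (i.succAbove a₀)).left.ker.support : Set (𝕏 (n + 1), m).left) =
        fermatCoordHyperplane (n + 1) m (i.succAbove a₀) := by
      rw [Scheme.Hom.support_ker, range_fermatSection,
        (isClosed_fermatCoordHyperplane (i.succAbove a₀)).closure_eq]
    exact h2 ▸ hsupp
  -- … but `W` and `{x_{k₀} ≠ 0}` are non-empty opens of the irreducible `Xⁿ⁺¹ₘ`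
  obtain ⟨z₀, hz₀⟩ := exists_notMem_fermatCoordHyperplane (n := n) hm (Fin.succAbove_ne i a₀).symm
  have hVopen : IsOpen {z : (𝕏 (n + 1), m).left | z ∉ fermatCoordHyperplane (n + 1) m (i.succAbove a₀)} :=
    (isClosed_fermatCoordHyperplane (i.succAbove a₀)).isOpen_compl
  obtain ⟨z, hzW, hzV⟩ := nonempty_preirreducible_inter (ιX ⁻¹ᵁ (WP : Scheme.Opens ℙ)).isOpen
    hVopen hne ⟨z₀, hz₀⟩
  exact hzV (hWZ z hzW)

/-! ### The charts cover the section -/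

/-- A point of `ℙⁿ⁺²` is a relevant prime: some `xₗ` does not vanish at it (the irrelevant ideal is
generated by the variables, `ProjectiveSpace.irrelevant_le_span`). [folklore] -/
theorem exists_X_notMem_of_proj (p : Proj 𝓐) :
    ∃ l : Fin (n + 3), (X l : MvPolynomial (Fin (n + 3)) ℂ) ∉ p.asHomogeneousIdeal := by
  by_contra! h
  refine p.not_irrelevant_le ?_
  rw [← toIdeal_le_toIdeal_iff]
  refine le_trans (ProjectiveSpace.irrelevant_le_span (k := ℂ) (n := n + 2)) ?_
  rw [Ideal.span_le]
  rintro _ ⟨l, rfl⟩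
  exact h l

/-- **The charts `Xⁿ⁺¹ₘ ∩ D₊(xᵢ ∂ⱼF)` with `i, j ≠ k₀` cover `{x_{k₀} = 0} ∩ Xⁿ⁺¹ₘ`** (`m ≥ 1`): at a
point `𝔭 ∋ F, x_{k₀}` choose `xᵢ ∉ 𝔭`; then some `xⱼ ∉ 𝔭` with `j ≠ i` (else
`xᵢᵐ = F - Σ_{c ≠ i} x_cᵐ ∈ 𝔭`), and `∂ⱼF = m xⱼᵐ⁻¹ ∉ 𝔭`. The chart is recorded by
`(i, a₀, j')` with `k₀ = i.succAbove a₀`, `j = i.succAbove (a₀.succAbove j')`.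
[cite: ShiodaKatsura1979, §1 Lemma 1.2] [cite: Hartshorne1977, I Ex. 5.8] -/
theorem exists_chart_of_mem_fermatCoordHyperplane (hm : 1 ≤ m) (k₀ : Fin (n + 3))
    {z : (𝕏 (n + 1), m).left} (hz : z ∈ fermatCoordHyperplane (n + 1) m k₀) :
    ∃ (i₁ : Fin (n + 3)) (b : Fin (n + 2)) (j₁ : Fin (n + 1)), i₁.succAbove b = k₀ ∧
      z ∈ ιX ⁻¹ᵁ (chartOpen F hF i₁ (b.succAbove j₁) : (Proj 𝓐).Opens) := by
  have hm0 : m ≠ 0 := Nat.one_le_iff_ne_zero.mp hm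
  set p : Proj 𝓐 := ιX z with hp
  -- `F, x_{k₀} ∈ 𝔭`
  have hpF : F ∈ p.asHomogeneousIdeal := by
    have : p ∈ ProjectiveSpectrum.zeroLocus 𝓐 {F} :=
      (Set.ext_iff.mp (SmoothHypersurface.range_hypersurfaceι F) p).mp ⟨z, rfl⟩
    exact Set.singleton_subset_iff.mp this
  have hpk : (X k₀ : MvPolynomial (Fin (n + 3)) ℂ) ∈ p.asHomogeneousIdeal :=
    Set.singleton_subset_iff.mp ((mem_fermatCoordHyperplane_iff k₀ z).mp hz)
  have hprime := p.isPrime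
  -- `xᵢ ∉ 𝔭`, `i ≠ k₀`
  obtain ⟨i₁, hi₁⟩ := exists_X_notMem_of_proj (n := n) p
  have hik : k₀ ≠ i₁ := fun h ↦ hi₁ (h ▸ hpk)
  obtain ⟨b, hb⟩ := Fin.exists_succAbove_eq hik
  -- some `xⱼ ∉ 𝔭` with `j ≠ i`
  obtain ⟨j, hji, hj⟩ : ∃ j, j ≠ i₁ ∧ (X j : MvPolynomial (Fin (n + 3)) ℂ) ∉ p.asHomogeneousIdeal := by
    by_contra! h
    apply hi₁
    have hsum : (∑ c ∈ Finset.univ.erase i₁, (X c : MvPolynomial (Fin (n + 3)) ℂ) ^ m) ∈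
        p.asHomogeneousIdeal :=
      Ideal.sum_mem _ fun c hc ↦ Ideal.pow_mem_of_mem _ (h c (Finset.ne_of_mem_erase hc)) _ hm
    have hXi : (X i₁ : MvPolynomial (Fin (n + 3)) ℂ) ^ m ∈ p.asHomogeneousIdeal := by
      have hF' : (X i₁ : MvPolynomial (Fin (n + 3)) ℂ) ^ m =
          F - ∑ c ∈ Finset.univ.erase i₁, (X c : MvPolynomial (Fin (n + 3)) ℂ) ^ m := by
        rw [fermatPolynomial, ← Finset.add_sum_erase _ _ (Finset.mem_univ i₁), add_sub_cancel_right]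
      rw [hF']
      exact Ideal.sub_mem _ hpF hsum
    exact hprime.mem_of_pow_mem _ hXi
  have hjk : j ≠ k₀ := fun h ↦ hj (h ▸ hpk)
  obtain ⟨b', hb'⟩ := Fin.exists_succAbove_eq hji
  have hb'b : b' ≠ b := by
    rintro rfl
    exact hjk (hb'.symm.trans hb)
  obtain ⟨j₁, hj₁⟩ := Fin.exists_succAbove_eq hb'b
  refine ⟨i₁, b, j₁, hb, ?_⟩
  -- `z ∈ ι⁻¹ D₊(xᵢ ∂ⱼF)`: `xᵢ ∂ⱼF = m xᵢ xⱼᵐ⁻¹ ∉ 𝔭`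
  change p ∈ Proj.basicOpen 𝓐 (X i₁ * pderiv (i₁.succAbove (b.succAbove j₁)) F)
  rw [hj₁, hb', Proj.mem_basicOpen]
  change X i₁ * pderiv j F ∉ p.asHomogeneousIdeal
  rw [fermatPolynomial, SmoothHypersurface.pderiv_sum_X_pow,
    ← map_natCast (C : ℂ →+* MvPolynomial (Fin (n + 3)) ℂ) m, ← mul_assoc, ← HomogeneousIdeal.mem_iff,
    hprime.mul_mem_iff_mem_or_mem, not_or, hprime.mul_mem_iff_mem_or_mem, not_or]
  refine ⟨⟨hi₁, fun hC ↦ hprime.ne_top ?_⟩, fun hpow ↦ hj (hprime.mem_of_pow_mem _ hpow)⟩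
  exact Ideal.eq_top_of_isUnit_mem _ hC ((IsUnit.mk0 _ (Nat.cast_ne_zero.mpr hm0)).map C)

end Fermat

end Literature.AlgebraicGeometry.HodgeTheory

end
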